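import Summits.CriticalPhenomena.PercolationContinuityZ3.Theorems.PercNearOneGluingNoHeavyLowerTailIncStarWDOMBottomSink
import Summits.CriticalPhenomena.PercolationContinuityZ3.Theorems.PercNearOneGluingNoHeavyLowerTailIncStarWDOMAllOrNothingTarget
import HarnessLib

/-!
# A two-pronged TARGET is a sink: `E[W | target hangs on s and j only] ≤ E[W]` for every finite weighted graph (Sahi programme, prover prim-sahi-p2 gen 36)

Support file (`--supports stmt-CriticalPhenomena-4575`); no definitions, no named facts, no sorries; standard axioms.  Memo
`run/shared/lean/prim/prim-sahi/FROM-prim-sahi-p2-gen36-ALL-OR-NOTHING.md` §0(2g), `prim-sahi-p2/PROOF-E3.md` §46.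

Twin of `bottomSink` at a target: with `F` the pairs at the target `i` other than `i–s`, `i–j` and `P⁰` the law with `F` closed,
**`targetSink`**: `2·P⁰(B_i ∩ B_j) − q_i·P⁰(B_j) − q_j·P⁰(B_i) ≤ 2q_{ij} − 2q_iq_j` (constants of `G`), i.e. in the language of gen 34, `DEL(G, G ∖ F) ≥ 0` for the
star of a target — whereas `DEL ≥ 0` is false for general deletions.  Proof: pattern decomposition (`real_patternDecomp`), the all-or-nothing lemma at a target
(`allOrNothing_target`) for every pattern, Harris on the pattern cube (`patSum_chebyshev`).
-/

noncomputable section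

namespace Summit.CriticalPhenomena.PercolationContinuityZ3.Theorems

namespace IncStar

open MeasureTheory Set Literature.Probability.Percolation Literature.Probability.LatticeModels EdgeInduction
open scoped Classical

variable {n : ℕ}

/-- **TARGET-SINK THEOREM.**  `s, i, j` distinct; `F` a finite set of pairs containing the target `i`, with `s(i,s), s(i,j) ∉ F`, covering every other pair at `i` of
positive weight; `w⁰ = w[F ↦ 0]`.  Then `2·P_{w⁰}(B_i∩B_j) − q_i·P_{w⁰}(B_j) − q_j·P_{w⁰}(B_i) ≤ 2q_{ij} − 2q_iq_j` (constants of `G`). [this work] -/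
theorem targetSink (w : Sym2 (Fin n) → unitInterval) {s i j : Fin n} (his : i ≠ s) (hjs : j ≠ s) (hij : i ≠ j)
    (F : Finset (Sym2 (Fin n))) (hF : ∀ e ∈ F, i ∈ e) (hFs : s(i, s) ∉ F) (hFj : s(i, j) ∉ F)
    (hcover : ∀ v : Fin n, v ≠ i → v ≠ s → v ≠ j → s(i, v) ∈ F ∨ w s(i, v) = 0)
    (w0 : Sym2 (Fin n) → unitInterval) (hw0 : w0 = fun e => if e ∈ F then 0 else w e) :
    2 * (prodBernoulli w0).real (openConn s i ∩ openConn s j)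
      - (prodBernoulli w).real (openConn s i) * (prodBernoulli w0).real (openConn s j)
      - (prodBernoulli w).real (openConn s j) * (prodBernoulli w0).real (openConn s i)
      ≤ 2 * (prodBernoulli w).real (openConn s i ∩ openConn s j)
        - 2 * ((prodBernoulli w).real (openConn s i) * (prodBernoulli w).real (openConn s j)) := by
  set Bi : Set (BondConfig (Fin n)) := openConn s i with hBi
  set Bj : Set (BondConfig (Fin n)) := openConn s j with hBj
  have htarget0 : ∀ v : Fin n, v ≠ i → v ≠ s → v ≠ j → w0 s(i, v) = 0 := by
    intro v hv hs hj
    rw [hw0]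
    rcases hcover v hv hs hj with h | h
    · simp only [h, if_true]
    · by_cases hm : s(i, v) ∈ F
      · simp only [hm, if_true]
      · simp only [hm, if_false, h]
  -- pattern laws and their monotonicity
  have hpatw : ∀ O : Finset (Sym2 (Fin n)), O ⊆ F →
      (fun e => if e ∈ O then (1 : unitInterval) else if e ∈ F then 0 else w e) = (fun e => if e ∈ O then 1 else w0 e) := by
    intro O _; rw [hw0]
  have mono : ∀ X : Set (BondConfig (Fin n)), IsUpperSet X → ∀ O O' : Finset (Sym2 (Fin n)), O ⊆ O' →
      (prodBernoulli (fun e => if e ∈ O then (1 : unitInterval) else w0 e)).real X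
        ≤ (prodBernoulli (fun e => if e ∈ O' then (1 : unitInterval) else w0 e)).real X := by
    intro X hX O O' hOO'
    calc (prodBernoulli (fun e => if e ∈ O then (1 : unitInterval) else w0 e)).real X
        ≤ (prodBernoulli (fun e => if e ∈ O then (1 : unitInterval) else w0 e)).real
            ((fun ω : BondConfig (Fin n) => ω ∪ (↑O' : Set (Sym2 (Fin n)))) ⁻¹' X) :=
          measureReal_mono fun ω hω => hX Set.subset_union_left hω
      _ = (prodBernoulli (fun e => if e ∈ O' then (1 : unitInterval) else w0 e)).real X := by
          rw [← real_map_union]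
          refine congrArg (fun v : Sym2 (Fin n) → unitInterval => (prodBernoulli v).real X) ?_
          funext e
          by_cases h' : e ∈ O'
          · simp [h']
          · have h'' : e ∉ O := fun h => h' (hOO' h)
            simp [h', h'']
  -- decompositions of the constants
  have dI := real_patternDecomp F w Bi
  have dJ := real_patternDecomp F w Bj
  have dIJ := real_patternDecomp F w (Bi ∩ Bj)
  have hone := patSum_one w F
  simp only [mul_one] at hone
  -- the all-or-nothing lemma on every pattern
  have aon : ∀ O ∈ F.powerset,
      (prodBernoulli (fun e => if e ∈ O then (1 : unitInterval) else w0 e)).real Bi *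
          ((prodBernoulli (fun e => if e ∈ O then (1 : unitInterval) else w0 e)).real Bj - (prodBernoulli w0).real Bj)
        + (prodBernoulli (fun e => if e ∈ O then (1 : unitInterval) else w0 e)).real Bj *
          ((prodBernoulli (fun e => if e ∈ O then (1 : unitInterval) else w0 e)).real Bi - (prodBernoulli w0).real Bi)
        ≤ 2 * ((prodBernoulli (fun e => if e ∈ O then (1 : unitInterval) else w0 e)).real (Bi ∩ Bj) - (prodBernoulli w0).real (Bi ∩ Bj)) := by
    intro O hO
    have hOF : O ⊆ F := Finset.mem_powerset.1 hO
    exact allOrNothing_target w0 _ his hjs hij (↑O : Set (Sym2 (Fin n))) (fun e he => hF e (hOF (Finset.mem_coe.1 he)))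
      (fun h => hFs (hOF (Finset.mem_coe.1 h))) (fun h => hFj (hOF (Finset.mem_coe.1 h))) htarget0
      (by funext e; by_cases h : e ∈ O <;> simp [h])
  -- Harris on the pattern cube for `O ↦ A_O`, `O ↦ B_O`
  have cheb := patSum_chebyshev w F (fun O => (prodBernoulli (fun e => if e ∈ O then (1 : unitInterval) else w0 e)).real Bi)
    (fun O => (prodBernoulli (fun e => if e ∈ O then (1 : unitInterval) else w0 e)).real Bj)
    (fun O O' h => mono Bi (isUpperSet_openConn s i) O O' h) (fun O O' h => mono Bj (isUpperSet_openConn s j) O O' h)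
  -- rewrite the decompositions in terms of the pattern laws `w0[O ↦ 1]`
  rw [Finset.sum_congr rfl (fun O hO => by rw [hpatw O (Finset.mem_powerset.1 hO)])] at dI dJ dIJ
  -- sum the all-or-nothing inequalities with the pattern weights
  have hsum : 0 ≤ ∑ O ∈ F.powerset, ((∏ e ∈ O, (w e : ℝ)) * ∏ e ∈ F \ O, (1 - (w e : ℝ))) *
      (2 * ((prodBernoulli (fun e => if e ∈ O then (1 : unitInterval) else w0 e)).real (Bi ∩ Bj) - (prodBernoulli w0).real (Bi ∩ Bj))
        - ((prodBernoulli (fun e => if e ∈ O then (1 : unitInterval) else w0 e)).real Bi *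
            ((prodBernoulli (fun e => if e ∈ O then (1 : unitInterval) else w0 e)).real Bj - (prodBernoulli w0).real Bj)
          + (prodBernoulli (fun e => if e ∈ O then (1 : unitInterval) else w0 e)).real Bj *
            ((prodBernoulli (fun e => if e ∈ O then (1 : unitInterval) else w0 e)).real Bi - (prodBernoulli w0).real Bi))) :=
    Finset.sum_nonneg fun O hO => mul_nonneg (al5u_pi_nonneg w F O) (by linarith [aon O hO])
  -- expand the sum
  have hexp : ∑ O ∈ F.powerset, ((∏ e ∈ O, (w e : ℝ)) * ∏ e ∈ F \ O, (1 - (w e : ℝ))) *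
      (2 * ((prodBernoulli (fun e => if e ∈ O then (1 : unitInterval) else w0 e)).real (Bi ∩ Bj) - (prodBernoulli w0).real (Bi ∩ Bj))
        - ((prodBernoulli (fun e => if e ∈ O then (1 : unitInterval) else w0 e)).real Bi *
            ((prodBernoulli (fun e => if e ∈ O then (1 : unitInterval) else w0 e)).real Bj - (prodBernoulli w0).real Bj)
          + (prodBernoulli (fun e => if e ∈ O then (1 : unitInterval) else w0 e)).real Bj *
            ((prodBernoulli (fun e => if e ∈ O then (1 : unitInterval) else w0 e)).real Bi - (prodBernoulli w0).real Bi)))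
      = 2 * (prodBernoulli w).real (Bi ∩ Bj) - 2 * (prodBernoulli w0).real (Bi ∩ Bj)
        - 2 * ∑ O ∈ F.powerset, ((∏ e ∈ O, (w e : ℝ)) * ∏ e ∈ F \ O, (1 - (w e : ℝ))) *
            ((prodBernoulli (fun e => if e ∈ O then (1 : unitInterval) else w0 e)).real Bi *
              (prodBernoulli (fun e => if e ∈ O then (1 : unitInterval) else w0 e)).real Bj)
        + (prodBernoulli w0).real Bj * (prodBernoulli w).real Bi + (prodBernoulli w0).real Bi * (prodBernoulli w).real Bj := by
    rw [dI, dJ, dIJ]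
    have h2 : (2 : ℝ) * (prodBernoulli w0).real (Bi ∩ Bj) = 2 * (prodBernoulli w0).real (Bi ∩ Bj) *
        ∑ O ∈ F.powerset, ((∏ e ∈ O, (w e : ℝ)) * ∏ e ∈ F \ O, (1 - (w e : ℝ))) := by rw [hone, mul_one]
    rw [h2]
    simp only [Finset.mul_sum]
    rw [← Finset.sum_sub_distrib, ← Finset.sum_sub_distrib, ← Finset.sum_add_distrib, ← Finset.sum_add_distrib]
    exact Finset.sum_congr rfl fun O _ => by ring
  rw [hexp] at hsum
  rw [← dI, ← dJ] at cheb
  linarith [hsum, cheb]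

end IncStar

end Summit.CriticalPhenomena.PercolationContinuityZ3.Theorems
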